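import Summits.ResolutionOfSingularities.ResolutionOfSingularities.Theorems.FrobeniusClosingSteerWords22PointTailFork
import Summits.ResolutionOfSingularities.ResolutionOfSingularities.Theorems.FrobeniusClosingSteerWords21ConstOrderReduction
import Summits.ResolutionOfSingularities.ResolutionOfSingularities.Theorems.FrobeniusClosingSteerStrippedThreadInfinitelyHitH
import Summits.ResolutionOfSingularities.ResolutionOfSingularities.Theorems.FrobeniusClosingSteerLowTaming

/-!
# Crux `Steer` (stmt-ResolutionOfSingularities-16345), line `switching-dichotomy` — WORDS 23: §σ2.26 F-A3 AND THE HEIGHT SPLIT IN THE v2.2 CURRENCY (`StrippedThreadTwoNH`, `highWanderConclTwoN_of_heightSplitH`, `eternalSteeredRunTwo_of_slate2H`, slate7), the NH leaves `strippedThreadTwoNH_of_L7` (res-D-pv-003) / `strippedThreadTwoNH_holds` (+ res-D-pv-004 (L7) p528709) and slate7′ (HOIST of the registered skeleton r49 bb092f8f650aca19, l.1963–2233, inside `section HeightSplitTwo` with its `variable {K : Type} [Field K]`)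

Holder res-L0-w41-lead-1 g6 on res-L0-w41-plan-1 RULING 47 (E1) / 104b; see `…Words01Core` for the hoist protocol (bodies byte for byte;
`[cite: …]` / `[folklore]` tags on CLOSED `def … : Prop` words are written «(ref. …)» / «(folklore)» — GATE NOTE of `…Words02Stubs`;
cite keys inside `[cite:]` tags normalised to `references.bib` keys where needed, as in `…Words03Phases`).
Nothing here is a statement of the manuscript [claim: Hironaka2017, status: under-review]. OURS (candidates / vocabulary; AI review is
weaker than expert review).
-/

open Summit.ResolutionOfSingularities.ResolutionOfSingularities.Theses.FrobeniusClosing (IsolatedForcedTermination)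
open Literature.AlgebraicGeometry.Resolution (IsAbhyankarPlace FGOver exists_ringKrullDim_eq_and_trdeg_eq
  trdeg_eq_trdeg_of_isFractionRing locAtCentre IsQuadraticTransformAlong SubringDominates IsRsopPart
  LocalUniformization3 RelLocalUniformization CossartPiltant2019General)
open Summit.ResolutionOfSingularities.ResolutionOfSingularities.Theorems.SteerRankThinness
  (HasProperCoarsening concl_of_hasProperCoarsening rankOne_of_not_hasProperCoarsening)
open Summit.ResolutionOfSingularities.ResolutionOfSingularities.Theorems.PfaffLine

set_option linter.dupNamespace false

namespace Summit.ResolutionOfSingularities.ResolutionOfSingularities.Theorems.SwitchingDichotomy.Words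

section SteeredTwo

open IsLocalRing
open Literature.AlgebraicGeometry.Resolution (IsLocalBlowupAlong IsQuadraticTransform IsExcellentRing)

variable {K : Type} [Field K]


/-- **F-B ⟸ Θ♮ ∧ G-TAME(4, p·e) (e ≥ 2) ∧ F-B-wild** — the shape slate7 consumes (plan-1 RULING 86b/d). Pure logic. OURS. [folklore] -/
theorem strippingTailHighConclTwoN_of_pieces (hΘ : PointTailChainTwoN)
    (hG4 : ∀ p : ℕ, p.Prime → ∀ e : ℕ, 2 ≤ e → NoEternalConstOrderIsolatedChainPerfect p 4 (p * e))
    (hW : StrippingTailWildConclTwoN) : StrippingTailHighConclTwoN :=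
  strippingTailHighConclTwoN_of_fork
    (strippingTailIsolatedConclTwoN_of_chain hΘ (noEternalStrippedRadicandChainHP_four_of_pieces hG4)) hW

/-! ##### F-A3 and the height split in the v2.2 currency; the T-line candidate slate7 -/

/-- **F-A3 · StrippedThreadTwoNH** (WORK — Θ1♭ packaging, res-D-pv-003 / res-D-pv-007, + (L7) member derivations, res-D-pv-004; plan-1 RULING
84b): `StrippedThreadTwoN` VERBATIM with the conclusion in the K♭ v2.2 currency — the packaged transversal-germ chain carries `x ∉ 𝔪′²`
and H. OURS. (folklore) -/
def StrippedThreadTwoNH : Prop :=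
  ∀ p : ℕ, p = 2 →
    ∀ (k K : Type) [Field k] [CharP k p] [PerfectField k] [Field K] [Algebra k K]
    (O : ValuationSubring K) (A₀ : Subalgebra k K) (h₀ : A₀.toSubring ≤ O.toSubring) (t : K),
    CoreDatum p 4 k K O A₀ h₀ t → ¬ HasProperCoarsening O →
    ∀ (R : ℕ → Subring K) (P : (i : ℕ) → Ideal (R i)) (s : ℕ → K),
      R 0 = locAtCentre A₀.toSubring O → NormalAt O (R 0) p t → IsSteeredRun O R P t p s →
      (¬ ∃ i₀ c : ℕ, 1 ≤ c ∧ IsDominantTail R P i₀ c) →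
      (∃ i₀ : ℕ, ∀ i, i₀ ≤ i → IsHighOrderAt R s p i) →
      ∀ J : Set ℕ, J.Infinite → (∀ i ∈ J, ∀ j ∈ J, i < j → IsAncestorStep R P i j) →
        (∀ j ∈ J, 2 ≤ (P j).height) → IsFinitelyHitTwo R P J → ¬ IsFinitelyHit R P J →
        ∃ c : ℕ, 2 ≤ c ∧ c ≤ 3 ∧ ¬ NoEternalStrippedRadicandChainH p c

/-- **THE HEIGHT SPLIT in the v2.2 currency** — `highWanderConclTwoN_of_heightSplit` VERBATIM (statement and proof) with `hA3`, `hS2`, `hS3`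
re-typed over `StrippedThreadTwoNH` / `NoEternalStrippedRadicandChainH`. PROVED. OURS. [folklore] -/
theorem highWanderConclTwoN_of_heightSplitH (hS : StrippingTailHighConclTwoN) (hB₂ : BirthWanderHighConclTwoN)
    (hC₂ : BranchWanderHighConclTwoN) (hA3 : StrippedThreadTwoNH) (hTi : FinitelyHitThreadTwoN) (hH : HitHeightLtTwoN)
    (hK1 : ∀ p : ℕ, p.Prime → NoEternalIsolatedRadicandChain p 1)
    (hK2 : ∀ p : ℕ, p.Prime → NoEternalIsolatedRadicandChain p 2)
    (hK3 : ∀ p : ℕ, p.Prime → NoEternalIsolatedRadicandChain p 3)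
    (hS2 : ∀ p : ℕ, p.Prime → NoEternalStrippedRadicandChainH p 2)
    (hS3 : ∀ p : ℕ, p.Prime → NoEternalStrippedRadicandChainH p 3) : HighWanderConclTwoN := by
  intro p hp2 k K _i1 _i2 _i3 _i4 _i5 O A₀ h₀ t core hrk R P s hR0 hN hrun hnd hio hhigh
  have hp : p.Prime := hp2 ▸ Nat.prime_two
  -- infinitely many positive steps
  have hinf : {j | IsPosStep R P j}.Infinite := by
    refine Set.infinite_of_not_bddAbove ?_
    rintro ⟨b, hb'⟩
    obtain ⟨i, hi, hnp⟩ := hio (b + 1)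
    obtain ⟨hl, -⟩ := hrun.2 i
    have := hb' (show i ∈ {j | IsPosStep R P j} from ⟨hl, fun h => hnp ⟨hl, h⟩⟩)
    omega
  by_cases h2 : HeightTwoStepsInfinite R P
  swap
  · exact hS p hp2 k K O A₀ h₀ t core hrk R P s hR0 hN hrun hnd hhigh h2 hinf
  by_cases hb : {j | IsRootStep R P j ∧ 2 ≤ (P j).height}.Infinite
  · exact hB₂ p hp2 k K O A₀ h₀ t core hrk R P s hR0 hN hrun hnd hhigh hb
  by_cases hc : ∃ i, 2 ≤ (P i).height ∧ {j | IsChildStep R P i j}.Infinite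
  · exact hC₂ p hp2 k K O A₀ h₀ t core hrk R P s hR0 hN hrun hnd hhigh hc
  exfalso
  have hroots : {j | IsRootStep R P j ∧ 2 ≤ (P j).height}.Finite := Set.not_infinite.mp hb
  have hbr : ∀ i, 2 ≤ (P i).height → {j | IsChildStep R P i j}.Finite := fun i hi =>
    Set.not_infinite.mp fun h => hc ⟨i, hi, h⟩
  have hmono : Monotone R := hrun.monotone
  obtain ⟨hle3, hhit⟩ := hH p hp2 k K O A₀ h₀ t core hrk R P s hR0 hN hrun
  -- descent on the height `h ≥ 2` carrying infinitely many positive steps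
  have main : ∀ h : ℕ, 2 ≤ h → {j | IsPosStep R P j ∧ (P j).height = (h : ℕ∞)}.Infinite → False := by
    intro h
    induction h using Nat.strong_induction_on with
    | _ h ih =>
      intro h2le hinfh
      have h2le' : (2 : ℕ∞) ≤ (h : ℕ∞) := by exact_mod_cast h2le
      -- localised graded König at height `h`
      obtain ⟨J, hJ, hA, hh⟩ := wanderForestKoenig_graded' R P hmono h hinfh
        (hroots.subset fun j hj => ⟨hj.1, by rw [Set.mem_setOf_eq] at hj; rw [hj.2]; exact h2le'⟩)
        (fun i hi => hbr i (by rw [hi]; exact h2le'))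
      have hJ2 : ∀ j ∈ J, 2 ≤ (P j).height := fun j hj => by rw [hh j hj]; exact h2le'
      by_cases hfin : IsFinitelyHit R P J
      · obtain ⟨c, hc1, hc3, hK⟩ := hTi p hp2 k K O A₀ h₀ t core hrk R P s hR0 hN hrun J hJ hA hfin
        interval_cases c
        · exact hK (hK1 p hp)
        · exact hK (hK2 p hp)
        · exact hK (hK3 p hp)
      by_cases hfin2 : IsFinitelyHitTwo R P J
      · obtain ⟨c, hc2, hc3, hK⟩ :=
          hA3 p hp2 k K O A₀ h₀ t core hrk R P s hR0 hN hrun hnd hhigh J hJ hA hJ2 hfin2 hfin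
        interval_cases c
        · exact hK (hS2 p hp)
        · exact hK (hS3 p hp)
      -- infinitely many hits of height `≥ 2`: positive steps of height in `[2, h)`
      obtain ⟨j₀, hj₀⟩ := hJ.nonempty
      have hH' : {m | IsPosStep R P m ∧ 2 ≤ (P m).height ∧ (P m).height < (h : ℕ∞)}.Infinite := by
        refine Set.infinite_of_not_bddAbove ?_
        rintro ⟨b, hb⟩
        apply hfin2
        refine ⟨max b j₀ + 1, fun m hm _ j hj hmj => ?_⟩
        have hj₀m : j₀ < m := by omega
        have hA₀ : IsAncestorStep R P j₀ j := hA j₀ hj₀ j hj (lt_trans hj₀m hmj.1.1)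
        obtain ⟨hpos, hlt⟩ := hhit j₀ m j hA₀ hj₀m hmj.1
        have hmb : m ≤ b := hb ⟨hpos, hmj.2, lt_of_lt_of_eq hlt (hh j hj)⟩
        omega
      obtain ⟨h', hh'n, hinf'⟩ :=
        exists_fibre_infinite_of_lt (fun m => (P m).height) h hH' fun m hm => hm.2.2
      obtain ⟨m₁, hm₁⟩ := hinf'.nonempty
      have h2' : 2 ≤ h' := by
        have h1 : (2 : ℕ∞) ≤ (h' : ℕ∞) := by
          have h3 := hm₁.1.2.1
          rw [show (P m₁).height = (h' : ℕ∞) from hm₁.2] at h3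
          exact h3
        exact_mod_cast h1
      exact ih h' hh'n h2' (hinf'.mono fun m hm => ⟨hm.1.1, hm.2⟩)
  -- start of the descent: pigeonhole on the positive steps of height `≥ 2` (heights `≤ 3 < 4`, Θ2 (a))
  obtain ⟨h₀, -, hinf₀⟩ := exists_fibre_infinite_of_lt (fun m => (P m).height) 4 h2 fun m hm =>
    lt_of_le_of_lt (hle3 m hm.1) (by exact_mod_cast (by norm_num : (3 : ℕ) < 4))
  obtain ⟨m₁, hm₁⟩ := hinf₀.nonempty
  have h2₀ : 2 ≤ h₀ := by
    have h1 : (2 : ℕ∞) ≤ (h₀ : ℕ∞) := by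
      have h3 := hm₁.1.2
      rw [show (P m₁).height = (h₀ : ℕ∞) from hm₁.2] at h3
      exact h3
    exact_mod_cast h1
  exact main h₀ h2₀ (hinf₀.mono fun m hm => ⟨hm.1.1, hm.2⟩)

/-- **THE HEIGHT SPLIT in the v2.2 currency, debts form** (cf. `highWanderConclTwoN_of_heightSplit_debts`). Pure logic. OURS. [folklore] -/
theorem highWanderConclTwoN_of_heightSplit_debtsH (hS : StrippingTailHighConclTwoN) (hB₂ : BirthWanderHighConclTwoN)
    (hC₂ : BranchWanderHighConclTwoN) (hA3 : StrippedThreadTwoNH) (hTi : FinitelyHitThreadTwoN) (hH : HitHeightLtTwoN)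
    (hL : Literature.AlgebraicGeometry.Resolution.Lipman1978NoEternalNormalBranch.{0})
    (hCP' : Literature.AlgebraicGeometry.Resolution.CossartPiltant2019LocalPermissible.{0})
    (hS2 : ∀ p : ℕ, p.Prime → NoEternalStrippedRadicandChainH p 2)
    (hS3 : ∀ p : ℕ, p.Prime → NoEternalStrippedRadicandChainH p 3) : HighWanderConclTwoN :=
  highWanderConclTwoN_of_heightSplitH hS hB₂ hC₂ hA3 hTi hH noEternalIsolatedRadicandChain_one_holds
    (noEternalIsolatedRadicandChain_two_of_lipman hL) (noEternalIsolatedRadicandChain_three_of_CP' hCP') hS2 hS3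

/-- `eternalSteeredRunTwo_of_slate2` VERBATIM in the v2.2 currency. Pure logic. OURS. [folklore] -/
theorem eternalSteeredRunTwo_of_slate2H (hN1 : NormalAtGeneratorTwo) (hB4 : NoHeightOneCarrierTwo)
    (hTi : FinitelyHitThreadTwoN) (hH : HitHeightLtTwoN)
    (hS : StrippingTailHighConclTwoN) (hB₂ : BirthWanderHighConclTwoN) (hC₂ : BranchWanderHighConclTwoN)
    (hA3 : StrippedThreadTwoNH)
    (hS2 : ∀ p : ℕ, p.Prime → NoEternalStrippedRadicandChainH p 2)
    (hS3 : ∀ p : ℕ, p.Prime → NoEternalStrippedRadicandChainH p 3)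
    (hLow : Literature.AlgebraicGeometry.Resolution.Lipman1978ValuativeQuadraticSequence.{0} → LowOrderTailConclTwoN)
    (hL : Literature.AlgebraicGeometry.Resolution.Lipman1978NoEternalNormalBranch.{0})
    (hLV : Literature.AlgebraicGeometry.Resolution.Lipman1978ValuativeQuadraticSequence.{0})
    (hCP' : Literature.AlgebraicGeometry.Resolution.CossartPiltant2019LocalPermissible.{0}) : EternalSteeredRunTwo :=
  eternalSteeredRunTwo_of_normalised_split_debts (normalisedStartTwo_of_normalAtGenerator hN1)
    (pointTailHighConclTwo_of_B4 hB4)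
    (highWanderConclTwoN_of_heightSplit_debtsH hS hB₂ hC₂ hA3 hTi hH hL hCP' hS2 hS3) (hLow hLV) hL
    (_root_.Summit.ResolutionOfSingularities.ResolutionOfSingularities.Theorems.SwitchingDichotomy.HironakaLUBranchOfCP.hironakaLUIsolatedBranch_of_localPermissible hCP')

/-! #### §σ2.26 F-A3 (v2.2 currency) — `StrippedThreadTwoNH` modulo (L7) (adoption leaf, res-D-pv-003 Θ1♭; res-L0-w41-plan-1 RULING 90 (ii))

INSERTION RECIPE (holder only): imports `…Theorems.FrobeniusClosingSteerStrippedThreadInfinitelyHitH` (p526774) and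
`…Theorems.FrobeniusClosingSteerCleanerDescent` (p523530); paste right before `eternalSteeredRunTwo_of_slate7` (after `StrippedThreadTwoNH` and
the HeightSplitTwoH block). New name: `strippedThreadTwoNH_of_L7`. 0 sorries. When res-D-pv-004's (L7)
`MemberDerivations.hasCleaningDerivations_of_essFiniteType_perfect` lands (p526306 + its EFT sequel), the holder closes
`theorem strippedThreadTwoNH_holds : StrippedThreadTwoNH := strippedThreadTwoNH_of_L7 (fun p _ _ _ S _ _ hc hE f g => by
haveI := hE; exact MemberDerivations.hasCleaningDerivations_of_essFiniteType_perfect p S hc f g)` (the two `HasCleaningDerivations`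
— skeleton word and pv-004's Theses-free re-declaration — have the same body). -/

/-- **F-A3 (v2.2) · `StrippedThreadTwoNH` HOLDS modulo (L7)** (adoption leaf over res-D-pv-003's Theses-free
`StrippedThread.exists_not_noEternalStrippedChainH_of_infinitelyHit` (…StrippedThreadInfinitelyHitH, p526774, over the CPS engine p526202);
the germ-level H is supplied by `hL7` = the EXACT (L7) signature agreed with res-D-pv-004 (11:01:52Z / 11:07:56Z) through res-type-096's
`GeoDict.algebraMap_mem_of_locChar` / `GeoDict.essFiniteType_of_locChar` (the transversal germ `(R i)_Q` is a localisation of the finitely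
generated model of the member, `SteeredExit.exists_model_of_tower`). OURS. -/
theorem strippedThreadTwoNH_of_L7
    (hL7 : ∀ {k K : Type} [Field k] [Field K] [Algebra k K] (p : ℕ) [Fact p.Prime] [CharP k p] [PerfectField k]
      (S : Subring K) [IsRegularLocalRing S] [Algebra k S],
      (∀ c : k, ((algebraMap k S c : S) : K) = algebraMap k K c) → Algebra.EssFiniteType k S →
      ∀ f g : S, HasCleaningDerivations p S f g) :
    StrippedThreadTwoNH := by
  intro p hp2 k K _ _ _ _ _ O A₀ h₀ t core _ R P s hR0 _ hrun _ _ J hJ hJA hJ2 hfin2 hinf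
  subst hp2
  haveI : Fact (Nat.Prime 2) := ⟨Nat.prime_two⟩
  haveI : CharP K 2 := charP_of_injective_algebraMap (algebraMap k K).injective 2
  obtain ⟨hfg, htp, hfr, hreg, -, hzd, -, -, -, -, -, -, htr, -⟩ := core
  have hmono : Monotone R := hrun.monotone
  obtain ⟨-, hstep⟩ := hrun
  have hsp : ∀ i, s i ^ 2 ∈ R i := fun i => by
    obtain ⟨_, hs, -⟩ := hstep i
    exact hs
  have hbl : ∀ i, IsLocalBlowupAlong O (R i) (P i) (R (i + 1)) := fun i => by
    obtain ⟨_, _, -, hbl, -⟩ := hstep i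
    exact hbl
  have h0 : IsRegularLocalRing (R 0) := by
    rw [hR0]
    exact (Literature.AlgebraicGeometry.Resolution.isRegularLocalRing_locAtCentre_iff h₀).mpr hreg
  have hregR : ∀ i, IsRegularLocalRing (R i) := fun i =>
    _root_.Summit.ResolutionOfSingularities.ResolutionOfSingularities.Theorems.SwitchingDichotomy.SteeredMembersRegular.isRegularLocalRing_steps (O := O) R P i h0 (fun j _ => by
      obtain ⟨hloc, hs, hσ, hblj, -⟩ := hstep j
      refine ⟨hloc, ?_, hblj⟩
      rcases hσ with hperm | ⟨hP, -, -⟩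
      · exact Or.inl hperm.2.2.1
      · exact Or.inr hP) i le_rfl
  have hdim : ∀ i, ringKrullDim (R i) = (4 : ℕ) := fun i =>
    _root_.Summit.ResolutionOfSingularities.ResolutionOfSingularities.Theorems.SwitchingDichotomy.TailCodim.ringKrullDim_member_eq
      k K O A₀ h₀ t two_pos hfg htp hfr hzd htr R i hR0 fun j _ => (hbl j).isLocalBlowup
  have hheight : ∀ (i m : ℕ) (hle : R i ≤ R m) (Q : Ideal (R m)) [Q.IsPrime],
      Q.height ≤ (Q.comap (Subring.inclusion hle)).height := by
    intro i m hle Q _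
    by_cases him : i ≤ m
    · exact _root_.Summit.ResolutionOfSingularities.ResolutionOfSingularities.Theorems.SwitchingDichotomy.TowerHeight.height_le_height_comap_of_tower
        O A₀ h₀ hfg t 2 two_pos htp hfr R hR0 (fun j => (hbl j).isLocalBlowup) him hle Q
    · have e : R i = R m := le_antisymm hle (hmono (le_of_not_ge him))
      have key : ∀ (A B : Subring K) (_ : A = B) (h : A ≤ B) (Q : Ideal B) [Q.IsPrime],
          Q.height ≤ (Q.comap (Subring.inclusion h)).height := by
        intro A B e h Q _
        subst e
        have hQ : Q.comap (Subring.inclusion h) = Q := by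
          ext y
          rw [Ideal.mem_comap]
          rfl
        rw [hQ]
      exact key _ _ e hle Q
  have hvis : ∀ i, (∃ _ : IsLocalRing (R i), P i ≠ maximalIdeal (R i)) →
      (P i).IsPrime ∧ (∃ g : R i, (⟨s i ^ 2, hsp i⟩ : R i) - g ^ 2 ∈ P i ^ 2) ∧
      (∀ (Q : Ideal (R i)) [Q.IsPrime], Q < P i →
        IsRegularLocalRing (AdjoinRoot ((Polynomial.X : Polynomial (Localization.AtPrime Q)) ^ 2 -
          Polynomial.C (algebraMap (R i) (Localization.AtPrime Q) ⟨s i ^ 2, hsp i⟩)))) ∧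
      (∀ _ : (P i).IsPrime, ¬ IsRegularLocalRing (AdjoinRoot ((Polynomial.X : Polynomial (Localization.AtPrime (P i))) ^ 2 -
          Polynomial.C (algebraMap (R i) (Localization.AtPrime (P i)) ⟨s i ^ 2, hsp i⟩)))) ∧
      IsRegularLocalRing (R i ⧸ P i) := by
    intro i ⟨_, hne⟩
    obtain ⟨hloc, hs, hσ, -, -⟩ := hstep i
    have hperm : IsPermissibleCentre (R i) 2 ⟨s i ^ 2, hsp i⟩ (P i) := by
      rcases hσ with hperm | ⟨hP, -, -⟩
      · exact hperm
      · exact absurd hP hne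
    obtain ⟨hPi, hsing, hmc, -⟩ := hperm.2.1
    refine ⟨hPi, hperm.2.2.2, fun Q hQp hQ => ?_, fun _ => hsing, hperm.2.2.1⟩
    by_contra hnr
    exact hQ.ne (hmc Q hnr hQ.le)
  have hinf' : ∀ m₀ : ℕ, ∃ m, m₀ ≤ m ∧ m ∉ J ∧ ∃ l ∈ J, IsHitStep R P m l := by
    intro m₀
    by_contra h
    apply hinf
    exact ⟨m₀, fun m hm hmJ l hl hhit => h ⟨m, hm, hmJ, l, hl, hhit⟩⟩
  -- ### the germ-level H from (L7): a local ring `(R i)_Q ⊆ K` is a localisation of the finitely generated model, hence e.f.t. over `k`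
  have hH : ∀ (i : ℕ) (Q : Ideal (R i)) [Q.IsPrime] (S : Subring K) [IsLocalRing S],
      (∀ z : K, z ∈ S ↔ ∃ a b : R i, b ∉ Q ∧ z = (a : K) / b) → ∀ f g : S,
      (∀ N : ℕ, (∀ h : S, f - h ^ 2 ∉ IsLocalRing.maximalIdeal S ^ (N + 1)) → f - g ^ 2 ∈ IsLocalRing.maximalIdeal S ^ N →
        ∃ D : Derivation ℤ S S, D f ∉ IsLocalRing.maximalIdeal S ^ N ∨
          ((∀ y ∈ IsLocalRing.maximalIdeal S, D y ∈ IsLocalRing.maximalIdeal S) ∧ D f ∉ IsLocalRing.maximalIdeal S ^ (N + 1))) := by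
    intro i Q _ S _ hS f g
    obtain ⟨A₁, -, -, hfg₁, hRA₁⟩ :=
      _root_.Summit.ResolutionOfSingularities.ResolutionOfSingularities.Theorems.SwitchingDichotomy.SteeredExit.exists_model_of_tower
        O A₀ h₀ hfg hR0 (N := i) fun l _ => (hbl l).isLocalBlowup
    haveI := hregR i
    haveI : IsRegularLocalRing S :=
      _root_.Summit.ResolutionOfSingularities.ResolutionOfSingularities.Theorems.SwitchingDichotomy.GeoDict.isRegularLocalRing_of_locChar hS
    letI : Algebra k S := ((algebraMap k K).codRestrict S
      (_root_.Summit.ResolutionOfSingularities.ResolutionOfSingularities.Theorems.SwitchingDichotomy.GeoDict.algebraMap_mem_of_locChar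
        O A₁ hRA₁ hS)).toAlgebra
    have hcompat : ∀ c : k, ((algebraMap k S c : S) : K) = algebraMap k K c := fun c => rfl
    have hEFT : Algebra.EssFiniteType k S :=
      _root_.Summit.ResolutionOfSingularities.ResolutionOfSingularities.Theorems.SwitchingDichotomy.GeoDict.essFiniteType_of_locChar
        O A₁ hRA₁ hS hfg₁ hcompat
    exact hL7 2 S hcompat hEFT f g
  obtain ⟨c, hc2, hcn, -, hK⟩ :=
    _root_.Summit.ResolutionOfSingularities.ResolutionOfSingularities.Theorems.SwitchingDichotomy.StrippedThread.exists_not_noEternalStrippedChainH_of_infinitelyHit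
      2 O A₀ h₀ hfg R P s 4 hR0 hbl (fun i => by obtain ⟨_, _, -, -, hst⟩ := hstep i; exact hst) hsp hregR hdim
      hheight hvis (IsPosStep R P) (fun _ => Iff.rfl) (IsAncestorStep R P) (fun _ _ => Iff.rfl) J hJ hJA hJ2 hfin2 hinf'
      (fun S S' _ _ hle hqt ξ hξ hspan f G F hf hG hF e he hlaw =>
        _root_.Summit.ResolutionOfSingularities.ResolutionOfSingularities.Theorems.SwitchingDichotomy.CleanerDescent.cleaner_descent
          2 hle hqt hξ hspan hf hG hF he hlaw)
      (fun i Q _ S _ hS f g => hH i Q S hS f g)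
  exact ⟨c, hc2, by omega, hK⟩



/-- **F-A3 (v2.2) · `StrippedThreadTwoNH` HOLDS — hA3 CLOSED IN THE KERNEL** (r37): res-D-pv-003's `strippedThreadTwoNH_of_L7` fed with
res-D-pv-004 AS res-L0-w41-stub-10's (L7) tree theorem `MemberDerivations.hasCleaningDerivations_of_essFiniteType_perfect`
(`…Theorems.FrobeniusClosingSteerMemberDerivationsEFT`, p528709 ✓, over p526306 / p526976 and res-L0-w41-stub-4's (L7-Ω) frame files
p526975 / p527743 / p527744 / p528269); the two `HasCleaningDerivations` words (skeleton §σ2.26 v2 and pv-004's Theses-free re-declaration)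
have the same body. Recipe res-D-pv-003 11:22Z. OURS. [folklore] -/
theorem strippedThreadTwoNH_holds : StrippedThreadTwoNH :=
  strippedThreadTwoNH_of_L7 (fun p _ _ _ S _ _ hc hE f g => by
    haveI := hE
    exact _root_.Summit.ResolutionOfSingularities.ResolutionOfSingularities.Theorems.SwitchingDichotomy.MemberDerivations.hasCleaningDerivations_of_essFiniteType_perfect
      p S hc f g)

end SteeredTwo

end Summit.ResolutionOfSingularities.ResolutionOfSingularities.Theorems.SwitchingDichotomy.Words
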